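import Mathlib
import HarnessLib
import Summits.HubbardSuperconductivity.HubbardSuperconductivity.Theorems.KLProgrammeKLRegimeEngineFrameShellAsymmetry
import Summits.HubbardSuperconductivity.HubbardSuperconductivity.Theorems.KLProgrammeKLRegimeSplitBornOddnessLayer

/-!
# Route `KLProgramme` — ENGINE (stmt-HubbardSuperconductivity-20437 `KLRegimeEngineV17F2`), cure (C′) of located #22, bricks O2∘O3 composed:
# ODD MOMENTUM SUMS OF THE FRAME BAND OVER A SLICE SHELL ARE `O(Λ³L²) + O(ΛL)`
# (cell gate-hubbard-kl, seat hubbard-kl-k3c2-p2 g31, technique «thermal-bar induction n ≤ nScales β + 1 with EngineBoundsAtV4S sums»)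

WHY.  The localised born sum of binder #9's self-energy line is, after Matsubara parity (brick O1, `klod_sum_even_mul_propCT(_sq_mul_lin)`), a
momentum sum `Σ_{k̃ : |e_K(p_k̃)| ≤ Λ} F(e_K(p_k̃))` with `F` ODD and `C¹` on `[−Λ, Λ]`.  Brick O2 (`klol_abs_sum_odd_le`) bounds it by `Λ·C_f·A`
with `A` the two-sided shell asymmetry, and the GEO brick O3 (`abs_card_sub_card_frameShell_le`) bounds `A`.  This file is the one-line composition
on the engine carrier `TorusSite 2 L`, `e_K(p_k̃) = nambuXiCT L μ K k̃`, under the C4a chart hypotheses (`B : BandBounds a b`, frame of `C²` size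
`A`, `2A < Dt_min`, tube `(−r, r)` with `[μ − r − A, μ + r + A] ⊂ (a, b)`):

* `abs_sum_odd_le_of_lipschitzOn` — brick O2 for `F` odd and LIPSCHITZ (not only `C¹`): Mathlib's FTC for absolutely continuous functions;
* `filter_shell_filter_lt_eq` / `filter_shell_filter_gt_eq` — the shell's one-sided sub-counts are the two-sided interval counts of O3;
* **`abs_sum_shell_odd_le`** — for `F` odd with `F(x) = ∫₀^x f` (`0 ≤ x ≤ Λ`), `|f| ≤ C_f` on `[0, Λ]`, `0 ≤ Λ`, `Λ + (4 + 2A)·2π/L < r`: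
  `|Σ_{k̃ : |e_K(p_k̃)| ≤ Λ} F(e_K(p_k̃))| ≤ Λ·C_f·(L/2π)²·(4π·jacR·Λ² + 4·(2π·π√2/(Dt_min − 2A))·((4 + 2A)·2π/L))`
  — per unit `L²/(2π)²` of `Σ_k̃ ↔ L²∫d²k/(2π)²` this is `Λ³·C_f·4π·jacR + Λ·C_f·16π³√2(4+2A)/((Dt_min − 2A)·L)`: the DOS-SLOPE size `∝ Λ³` (not the
  DOS size `∝ Λ`) that located #21's constant `c_T = (75/512)·N′` and CURE-C-PRIME-DESIGN §2 row 1 price, plus the lattice rounding `∝ 1/L ≤ 2^{−n}`;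
  `abs_sum_shell_odd_le_of_lipschitzOn` — the same for `F` Lipschitz on `[−Λ′, Λ′] ⊃ [−Λ, Λ]`.
Pure composition; no definitions; nothing asserts (c), K3 or superconductivity.
References: BGM 2006 §2.4, §2.9 [cite: BenfattoGiulianiMastropietro2006]; FST II App. B [cite: FeldmanSalmhoferTrubowitz1998].
-/

noncomputable section

namespace Summit.HubbardSuperconductivity.HubbardSuperconductivity.Theorems.EngineV8

set_option linter.dupNamespace false -- summit = problem name (single-conjunct summit), D-0017

open Real Set MeasureTheory Finset
open Literature.MathematicalPhysics.QuantumLattice Literature.MathematicalPhysics.QuantumLattice.BandSectorCounting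
open Literature.Probability.LatticeModels
open Summit.HubbardSuperconductivity.HubbardSuperconductivity.Theorems.DispersionFlow
open Summit.HubbardSuperconductivity.HubbardSuperconductivity.Theorems.KLRegimeSplit
open Summit.HubbardSuperconductivity.HubbardSuperconductivity.Theorems.PerturbedFermiCurve
open Summit.HubbardSuperconductivity.HubbardSuperconductivity.Theorems.C4a

/-! ## §1 Brick O2 for LIPSCHITZ odd functions (FTC for absolutely continuous functions), and the shell's one-sided sub-counts -/

/-- **Odd sums are asymmetry integrals — Lipschitz form of `klol_abs_sum_odd_le`**: for a finite family of levels `|e k| ≤ Λ` on `S`, `F` odd and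
`C`-Lipschitz on `[−Λ′, Λ′]` with `Λ < Λ′`, and the two-sided asymmetry `|#{t < e k} − #{e k < −t}| ≤ A` on `[0, Λ]`: `|Σ_{k ∈ S} F(e k)| ≤ Λ·C·A`
(`F(x) = ∫₀^x F′` by the fundamental theorem of calculus for absolutely continuous functions, `|F′| ≤ C`). [folklore] -/
theorem abs_sum_odd_le_of_lipschitzOn {ι : Type*} (S : Finset ι) (e : ι → ℝ) (F : ℝ → ℝ) {Λ Λ' A : ℝ} {C : NNReal}
    (hΛ : 0 ≤ Λ) (hΛ' : Λ < Λ') (hodd : ∀ x, F (-x) = -F x) (hlip : LipschitzOnWith C F (Set.Icc (-Λ') Λ'))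
    (he : ∀ k ∈ S, |e k| ≤ Λ)
    (hA : ∀ t ∈ Set.Icc 0 Λ, |((S.filter fun k => t < e k).card : ℝ) - ((S.filter fun k => e k < -t).card : ℝ)| ≤ A) :
    |∑ k ∈ S, F (e k)| ≤ Λ * (C * A) := by
  have hF0 : F 0 = 0 := by have h := hodd 0; rw [neg_zero] at h; linarith
  have hac : ∀ x, 0 ≤ x → x ≤ Λ → AbsolutelyContinuousOnInterval F 0 x := fun x hx0 hxΛ =>
    (hlip.mono (by rw [Set.uIcc_of_le hx0]; exact Set.Icc_subset_Icc (by linarith) (by linarith))).absolutelyContinuousOnInterval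
  refine klol_abs_sum_odd_le S e F (deriv F) hΛ hodd (fun x hx0 hxΛ => ?_) (hac Λ hΛ le_rfl).intervalIntegrable_deriv he
    (fun t ht => ?_) hA
  · rw [(hac x hx0 hxΛ).integral_deriv_eq_sub, hF0, sub_zero]
  · have h := norm_deriv_le_of_lipschitzOn (x₀ := t) (Icc_mem_nhds (by linarith [ht.1]) (by linarith [ht.2])) hlip
    rwa [Real.norm_eq_abs] at h


/-- For `0 ≤ t`: `{k̃ : |e k̃| ≤ Λ}.filter (t < e k̃) = {k̃ : t < e k̃ ∧ e k̃ ≤ Λ}`. -/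
theorem filter_shell_filter_lt_eq {ι : Type*} [Fintype ι] (e : ι → ℝ) {Λ t : ℝ} (ht : 0 ≤ t) :
    ((univ.filter fun k : ι => |e k| ≤ Λ).filter fun k => t < e k) = univ.filter fun k : ι => t < e k ∧ e k ≤ Λ := by
  rw [Finset.filter_filter]
  refine Finset.filter_congr fun k _ => ⟨fun h => ⟨h.2, (le_abs_self _).trans h.1⟩, fun h => ⟨abs_le.2 ⟨by linarith [h.1], h.2⟩, h.1⟩⟩

/-- For `0 ≤ t`: `{k̃ : |e k̃| ≤ Λ}.filter (e k̃ < −t) = {k̃ : −Λ ≤ e k̃ ∧ e k̃ < −t}`. -/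
theorem filter_shell_filter_gt_eq {ι : Type*} [Fintype ι] (e : ι → ℝ) {Λ t : ℝ} (ht : 0 ≤ t) :
    ((univ.filter fun k : ι => |e k| ≤ Λ).filter fun k => e k < -t) = univ.filter fun k : ι => -Λ ≤ e k ∧ e k < -t := by
  rw [Finset.filter_filter]
  refine Finset.filter_congr fun k _ => ⟨fun h => ⟨(abs_le.1 h.1).1, h.2⟩, fun h => ⟨abs_le.2 ⟨h.1, by linarith [h.2]⟩, h.2⟩⟩

/-! ## §2 Odd momentum sums over the slice shell of the frame band -/

section Chart

variable {a b : ℝ} (B : BandBounds a b) {K : TrigPolyC4v} {A : ℝ}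
  (hA : ∀ p : Momentum, ∀ j ≤ 2, ‖iteratedFDeriv ℝ j (frameShift K) p‖ ≤ A) (hADt : 2 * A < B.Dtmin)
  {μ r : ℝ} (hlo : a < μ - r - A) (hhi : μ + r + A < b)
include B hA hADt hlo hhi

/-- **ODD MOMENTUM SUMS OVER A SLICE SHELL OF THE FRAME BAND (bricks O2∘O3).**  For `F` odd with `F(x) = ∫₀^x f` on `[0, Λ]`, `f` interval
integrable with `|f| ≤ C_f` on `[0, Λ]`, `0 ≤ Λ` and `Λ + (4 + 2A)·2π/L < r`:
`|Σ_{k̃ : |e_K(p_k̃)| ≤ Λ} F(e_K(p_k̃))| ≤ Λ·C_f·(L/2π)²·(4π·jacR·Λ² + 4·(2π·π√2/(Dt_min − 2A))·((4 + 2A)·2π/L))`.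
[cite: BenfattoGiulianiMastropietro2006, §2.4 (2.40)–(2.41)] [cite: FeldmanSalmhoferTrubowitz1998, App. B] -/
theorem abs_sum_shell_odd_le {L : ℕ} [NeZero L] (F f : ℝ → ℝ) {Λ Cf : ℝ} (hΛ0 : 0 ≤ Λ) (hΛr : Λ + (4 + 2 * A) * (2 * π / L) < r)
    (hodd : ∀ x, F (-x) = -F x) (hF : ∀ x, 0 ≤ x → x ≤ Λ → F x = ∫ t in (0 : ℝ)..x, f t) (hf : IntervalIntegrable f volume 0 Λ)
    (hfb : ∀ t ∈ Set.Icc 0 Λ, |f t| ≤ Cf) :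
    |∑ k ∈ univ.filter (fun k : TorusSite 2 L => |nambuXiCT L μ K k| ≤ Λ), F (nambuXiCT L μ K k)| ≤
      Λ * (Cf * (((L : ℝ) / (2 * π)) ^ 2 *
        (4 * π * (1 / (B.Dtmin - 2 * A) ^ 2 + Real.pi * Real.sqrt 2 * (2 + 4 * A) / (B.Dtmin - 2 * A) ^ 3) * Λ ^ 2 +
          4 * (2 * π * (π * Real.sqrt 2 / (B.Dtmin - 2 * A))) * ((4 + 2 * A) * (2 * π / L))))) := by
  refine klol_abs_sum_odd_le _ (fun k => nambuXiCT L μ K k) F f hΛ0 hodd hF hf (fun k hk => (Finset.mem_filter.1 hk).2) hfb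
    fun t ht => ?_
  rw [filter_shell_filter_lt_eq _ ht.1, filter_shell_filter_gt_eq _ ht.1]
  exact abs_card_sub_card_frameShell_le B hA hADt hlo hhi hΛ0 hΛr t ht

/-- **Lipschitz form**: for `F` odd and `C`-Lipschitz on `[−Λ′, Λ′]`, `0 ≤ Λ < Λ′`, `Λ + (4 + 2A)·2π/L < r`:
`|Σ_{k̃ : |e_K(p_k̃)| ≤ Λ} F(e_K(p_k̃))| ≤ Λ·C·(L/2π)²·(4π·jacR·Λ² + 4·(2π·π√2/(Dt_min − 2A))·((4 + 2A)·2π/L))`. -/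
theorem abs_sum_shell_odd_le_of_lipschitzOn {L : ℕ} [NeZero L] (F : ℝ → ℝ) {Λ Λ' : ℝ} {C : NNReal} (hΛ0 : 0 ≤ Λ) (hΛ' : Λ < Λ')
    (hΛr : Λ + (4 + 2 * A) * (2 * π / L) < r) (hodd : ∀ x, F (-x) = -F x) (hlip : LipschitzOnWith C F (Set.Icc (-Λ') Λ')) :
    |∑ k ∈ univ.filter (fun k : TorusSite 2 L => |nambuXiCT L μ K k| ≤ Λ), F (nambuXiCT L μ K k)| ≤
      Λ * (C * (((L : ℝ) / (2 * π)) ^ 2 *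
        (4 * π * (1 / (B.Dtmin - 2 * A) ^ 2 + Real.pi * Real.sqrt 2 * (2 + 4 * A) / (B.Dtmin - 2 * A) ^ 3) * Λ ^ 2 +
          4 * (2 * π * (π * Real.sqrt 2 / (B.Dtmin - 2 * A))) * ((4 + 2 * A) * (2 * π / L))))) := by
  refine abs_sum_odd_le_of_lipschitzOn _ (fun k => nambuXiCT L μ K k) F hΛ0 hΛ' hodd hlip (fun k hk => (Finset.mem_filter.1 hk).2)
    fun t ht => ?_
  rw [filter_shell_filter_lt_eq _ ht.1, filter_shell_filter_gt_eq _ ht.1]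
  exact abs_card_sub_card_frameShell_le B hA hADt hlo hhi hΛ0 hΛr t ht

end Chart

end Summit.HubbardSuperconductivity.HubbardSuperconductivity.Theorems.EngineV8

end
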